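import Summits.AtomisticToContinuum.Crystallization.Theses.RepetitiveNetworkReduction
import Summits.AtomisticToContinuum.Crystallization.Theorems.RepetitiveNetworkReductionRecurrentMember
import Summits.AtomisticToContinuum.Crystallization.Theorems.RepetitiveNetworkReductionEvaporationLaw

/-!
# `RepetitiveNetworkReduction.NetworkRecurrenceTransfer` — the item BY NAME (composition of its two landed stubs)

Support item `NetworkRecurrenceTransfer` (RED, `stmt-AtomisticToContinuum-27236`) of route `RepetitiveNetworkReduction`
(sub-problem `Crystallization` of `AtomisticToContinuum`): from one rooted `δ`-hard-core, textured, Nash, `e⋆`-μ-ground-state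
counting measure, a point-stationary law of such configurations which are a.s. uniformly recurrent, with mean root energy
`≤ e⋆`. Proof = the registered skeleton's composition `NetworkRecurrenceTransfer_of` (skeleton of record sha256
`1c2fef87a5641791…`) with its two stubs now theorems of the tree:
`RepetitiveNetworkReductionRecurrentMember.stub_recurrentMember` (p803330) and
`RepetitiveNetworkReductionEvaporationLaw.stub_evaporationLaw` (this landing's part 3/3). Written by the decomp-a2c cell's
lens-2 g18 seat. [folklore]
-/

namespace Summit.AtomisticToContinuum.Crystallization.Theorems.RepetitiveNetworkReductionNetworkRecurrenceTransfer

/-- **`NetworkRecurrenceTransfer` holds**: recurrent member, then evaporation. [folklore] -/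
theorem networkRecurrenceTransfer :
    Summit.AtomisticToContinuum.Crystallization.Theses.RepetitiveNetworkReduction.NetworkRecurrenceTransfer := by
  intro δ hδ R₇ R₈ R₉ μ
  dsimp only
  intro hc ha hn hm
  have h1' := RepetitiveNetworkReductionRecurrentMember.stub_recurrentMember δ hδ R₇ R₈ R₉ μ
  dsimp only at h1'
  obtain ⟨ν, hc', ha', hn', hm', hur'⟩ := h1' hc ha hn hm
  have h2' := RepetitiveNetworkReductionEvaporationLaw.stub_evaporationLaw δ hδ R₇ R₈ R₉ ν
  dsimp only at h2'
  exact h2' hc' ha' hn' hm' hur'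

end Summit.AtomisticToContinuum.Crystallization.Theorems.RepetitiveNetworkReductionNetworkRecurrenceTransfer
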